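import Summits.ResolutionOfSingularities.ResolutionOfSingularities.Theorems.EquisingularLiftEquisingularLiftNatAdaptedEquation
import HarnessLib

/-!
# [OURS · L1 W4.5(b)] EL♮ helper H-COMB, part 2 — comb centres: the transform of a relative hypersurface at
# `ϖ`-distance one from a blown-up section, chart by chart

Support file of the crux chain w45b (cell `res-hironaka`, LADDER-RESOLUTION rung L, slot W4.5(b)), working crux
**EL♮ = `EquisingularLiftNat`** (stmt-ResolutionOfSingularities-20038; bookkeeping node stmt-ResolutionOfSingularities-15660),
research stub `stub_elnat_three` of line `sections`; helper **H-COMB `comb_centre_regular`** of CRUX-PLAN v3 §1.7/§4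
(res-L1-w45b-plan-1): «`C := St(ℓ̃) ⊂ Bl_{s•} S̃` — the strict transform of a relative line / curve `ℓ̃` in an `O`-smooth
carrier `S̃` blown up at sections `s_j` at `ϖ`-distance exactly 1 — is regular, `O`-flat, with reduced nodal special
fibre `ℓ′ + Σ e_j = π*Z − Σ e_j`» (the COMB device of the carrier game, worked case `H_F` points-first). Filed
`--supports stmt-ResolutionOfSingularities-20038` by res-L1-w45b-stub-3. OURS, elementary, kernel-checked; replaces
the role of NOTHING in H. Hironaka's manuscript and is NOT a statement of it. AI review is weaker than expert review.

## Model and dictionary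

The question is local over each section, and a section of the `O`-smooth carrier is, in local coordinates, the zero
section of `𝔸ⁿ_O = Spec O[X₀, …, X_{n-1}]` (`n = 2` for the surface carriers of EL♮(3); general `n` costs nothing
and also covers point blow-ups of the ambient). The blow-up of `𝔸ⁿ_O` along the zero section `V(X₀, …, X_{n-1})`
is covered by the charts `i : Fin n` with coordinate substitution
`θᵢ = bind₁ (fun j ↦ if j = i then X i else X i * X j)` (`X_j = Xᵢ·X'_j` for `j ≠ i`), exceptional divisor
`E = V(Xᵢ)`, restriction to `E` given by `ρᵢ = bind₁ (fun j ↦ if j = i then 0 else X j)`; these maps are written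
out in every statement (no `def`s). A relative hypersurface `ℓ̃ = V(g)`, `g ∈ O[X]`, lies at **`ϖ`-distance exactly
one** from the zero section iff `g(0) = u·ϖ` with `u ∈ Oˣ` (the section meets `ℓ̃` in the reduced point
`Spec O/(u ϖ) = Spec k`); then `θᵢ g` has no exceptional factor (total transform = strict transform) and

* `exists_chart_eq` / `chart_unique` / `coeff_zero_chart` — **chart identity**: `θᵢ g = g(0) + Xᵢ·h` with
  `ρᵢ h = aᵢ + Σ_{j ≠ i} a_j X_j`, the LINEAR PART of `g` (`a_j` = coefficient of `X_j`), `h` unique;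
  so `θᵢ g = u·ϖ + Xᵢ·h` is an `E`-adapted equation and part 1 applies:
* `comb_centre_regular` — `O[X]/(θᵢ g)` is a regular local ring at every prime containing `Xᵢ` (every point of the
  exceptional curve `e`; elsewhere the chart is isomorphic to `ℓ̃`);
* `comb_centre_exceptional_le` — `(θᵢ g) ≤ (ϖ, Xᵢ)`: the exceptional curve `e` lies on the centre (the comb tooth);
* `comb_centre_inter_exceptional` — `(O[X]/(θᵢ g))/(Xᵢ) ≃+* k[X]/(Xᵢ)`: `C ∩ E = e` REDUCED (multiplicity one);
* `comb_centre_specialFibre` — `(O[X]/(θᵢ g))/(ϖ) ≃+* k[X]/(Xᵢ·h̄)`: special fibre `e ∪ ℓ′`, `ℓ′ = V(h̄)` the strict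
  transform of `ℓ = V(ḡ)`;
* `comb_centre_flat` — if the linear part of `g` is non-zero mod `ϖ` (`ℓ` smooth at the point) the centre is `O`-flat;
* `comb_centre_exceptional_reduced` — then also `Xᵢ ∤ h̄` and `(Xᵢ, h̄) = (Xᵢ, āᵢ + Σ_{j≠i} ā_j X_j)`: `ℓ′` meets `e`
  transversally in the reduced linear locus (for `n = 2`, `i = 0`: the single point `X₁ = −ā₀/ā₁`, a NODE of
  `e + ℓ′`).

What is NOT here: the scheme-level glue (`IsBlowup`, strict transform as a blow-up — tree theorems
`exists_isBlowup_reducedStrictTransform`, `IsBlowup.isRegular_of_isRegular_subscheme`), the E1 condition `e_j ⊆ H_i`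
(helper H-CONE) and the AVOID lemma. The hypothesis «distance exactly one» is load-bearing: `g = X₁ − ϖ²` gives
`θ₀ g = X₀X₁ − ϖ²`, an `A₁`-singular point on `e`.

References (context; the statements are folklore chart computations): Q. Liu, *Algebraic Geometry and Arithmetic
Curves*, OUP 2002, §8.1; J. Kollár, *Lectures on Resolution of Singularities* (2007) §3; H. Matsumura,
*Commutative Ring Theory*, CUP 1986, Thm. 19.2.
-/

set_option linter.dupNamespace false -- mandated namespace of this single-conjunct summit

noncomputable section

namespace Summit.ResolutionOfSingularities.ResolutionOfSingularities.Theorems.EquisingularLiftNat.CombCentre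

open MvPolynomial IsLocalRing

variable {O : Type} [CommRing O]

/-! ## 4. The charts of the blow-up of `𝔸ⁿ_O` along the zero section

The `i`-th chart of `Bl_{V(X₀,…,X_{n-1})} 𝔸ⁿ_O` is `𝔸ⁿ_O` with coordinates `(X_i, (X'_j)_{j ≠ i})`,
`X_j = X_i · X'_j`; on functions it is the substitution
`θ_i := bind₁ (fun j ↦ if j = i then X i else X i * X j)`, the exceptional divisor is `E = V(X_i)`, and
restriction to `E` is `ρ_i := bind₁ (fun j ↦ if j = i then 0 else X j)`. -/

section Chart

variable {n : ℕ}

/-- **Chart identity.** For every `g ∈ O[X]`, the total transform `θ_i g` under the `i`-th blow-up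
chart is `g(0) + X_i · h` for an `h` whose restriction to the exceptional hyperplane `X_i = 0` is the
LINEAR PART of `g` read in the chart: `h|_{X_i = 0} = a_i + Σ_{j ≠ i} a_j X_j`, `a_j` the coefficient of
`X_j` in `g`. [folklore] -/
theorem exists_chart_eq (i : Fin n) (g : MvPolynomial (Fin n) O) :
    ∃ h : MvPolynomial (Fin n) O,
      bind₁ (fun j : Fin n => if j = i then X i else X i * X j) g = C (coeff 0 g) + X i * h ∧
      bind₁ (fun j : Fin n => if j = i then (0 : MvPolynomial (Fin n) O) else X j) h =
        ∑ j : Fin n, C (coeff (Finsupp.single j 1) g) * (if j = i then 1 else X j) := by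
  induction g using MvPolynomial.induction_on with
  | C a =>
    refine ⟨0, ?_, ?_⟩
    · rw [bind₁_C_right, coeff_zero_C, mul_zero, add_zero]
    · rw [map_zero, eq_comm]
      refine Finset.sum_eq_zero fun j _ => ?_
      rw [coeff_C, if_neg (Ne.symm (Finsupp.single_ne_zero.mpr one_ne_zero)), C_0, zero_mul]
  | add p q hp hq =>
    obtain ⟨hp, hp1, hp2⟩ := hp
    obtain ⟨hq, hq1, hq2⟩ := hq
    refine ⟨hp + hq, ?_, ?_⟩
    · rw [map_add, hp1, hq1, coeff_add, C_add]; ring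
    · rw [map_add, hp2, hq2, ← Finset.sum_add_distrib]
      refine Finset.sum_congr rfl fun j _ => ?_
      rw [coeff_add, C_add]; ring
  | mul_X p j hp =>
    obtain ⟨h, h1, h2⟩ := hp
    refine ⟨bind₁ (fun j : Fin n => if j = i then X i else X i * X j) p * (if j = i then 1 else X j),
      ?_, ?_⟩
    · have h0 : coeff 0 (p * X j) = 0 := by
        rw [coeff_mul_X', if_neg (by simp)]
      rw [map_mul, bind₁_X_right, h0, C_0, zero_add]
      split_ifs <;> ring
    · have hρ : bind₁ (fun j : Fin n => if j = i then (0 : MvPolynomial (Fin n) O) else X j)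
          (bind₁ (fun j : Fin n => if j = i then X i else X i * X j) p) = C (coeff 0 p) := by
        rw [h1, map_add, map_mul, bind₁_C_right, bind₁_X_right, if_pos rfl, zero_mul, add_zero]
      rw [map_mul, hρ]
      have hm : bind₁ (fun j : Fin n => if j = i then (0 : MvPolynomial (Fin n) O) else X j)
          (if j = i then 1 else X j) = (if j = i then 1 else X j) := by
        split_ifs with hji
        · rw [map_one]
        · rw [bind₁_X_right, if_neg hji]
      rw [hm]
      have hc : ∀ l : Fin n, coeff (Finsupp.single l 1) (p * X j) = if j = l then coeff 0 p else 0 := by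
        intro l
        rw [coeff_mul_X']
        by_cases hjl : j = l
        · subst hjl
          rw [if_pos (by simp), if_pos rfl, tsub_self]
        · rw [if_neg (by simp [hjl]), if_neg hjl]
      simp_rw [hc]
      rw [eq_comm, Finset.sum_eq_single j (fun l _ hlj => by rw [if_neg (Ne.symm hlj), C_0, zero_mul])
        (fun hj => absurd (Finset.mem_univ j) hj), if_pos rfl]

/-- The chart `h` is unique (`O` a domain). [folklore] -/
theorem chart_unique [IsDomain O] (i : Fin n) {g h h' : MvPolynomial (Fin n) O}
    (hh : bind₁ (fun j : Fin n => if j = i then X i else X i * X j) g = C (coeff 0 g) + X i * h)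
    (hh' : bind₁ (fun j : Fin n => if j = i then X i else X i * X j) g = C (coeff 0 g) + X i * h') :
    h = h' := by
  have := hh.symm.trans hh'
  exact mul_left_cancel₀ (X_ne_zero i) (add_left_cancel this)

/-- The chart map does not change the constant term: `(θ_i g)(0) = g(0)`. [folklore] -/
theorem coeff_zero_chart (i : Fin n) (g : MvPolynomial (Fin n) O) :
    coeff 0 (bind₁ (fun j : Fin n => if j = i then X i else X i * X j) g) = coeff 0 g := by
  obtain ⟨h, e, -⟩ := exists_chart_eq i g
  rw [e, coeff_add, coeff_C, if_pos rfl, coeff_X_mul', if_neg (by simp), add_zero]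

/-- For every `p ∈ O[X]`, `p - p|_{X_i = 0} ∈ (X_i)`. [folklore] -/
theorem sub_restrict_mem_span_X (i : Fin n) (p : MvPolynomial (Fin n) O) :
    p - bind₁ (fun j : Fin n => if j = i then (0 : MvPolynomial (Fin n) O) else X j) p ∈
      Ideal.span {(X i : MvPolynomial (Fin n) O)} := by
  induction p using MvPolynomial.induction_on with
  | C a => rw [bind₁_C_right, sub_self]; exact Ideal.zero_mem _
  | add p q hp hq =>
    rw [map_add, add_sub_add_comm]
    exact Ideal.add_mem _ hp hq
  | mul_X p j hp =>
    rw [map_mul, bind₁_X_right]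
    split_ifs with hji
    · rw [mul_zero, sub_zero, hji]
      exact Ideal.mul_mem_left _ _ (Ideal.mem_span_singleton_self _)
    · rw [← sub_mul]
      exact Ideal.mul_mem_right _ _ hp

end Chart

/-! ## 5. Linear parts and their reductions -/

section LinearPart

variable {n : ℕ}

/-- Coefficient extraction from a chart linear part `Σ_j c_j · m_j` (`m_i = 1`, `m_j = X_j` for `j ≠ i`):
the coefficient at the test monomial of index `j` is `c_j`. [folklore] -/
theorem coeff_linearPart {k : Type*} [CommRing k] (i j : Fin n) (c : Fin n → k) :
    coeff (if j = i then 0 else Finsupp.single j 1)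
      (∑ l : Fin n, C (c l) * (if l = i then (1 : MvPolynomial (Fin n) k) else X l)) = c j := by
  rw [coeff_sum]
  have hterm : ∀ l : Fin n, coeff (if j = i then 0 else Finsupp.single j 1)
      (C (c l) * (if l = i then (1 : MvPolynomial (Fin n) k) else X l)) = if l = j then c j else 0 := by
    intro l
    rw [coeff_C_mul]
    by_cases hli : l = i
    · subst hli
      rw [if_pos rfl, coeff_one]
      by_cases hjl : j = l
      · subst hjl; simp
      · rw [if_neg hjl, if_neg (Ne.symm hjl), if_neg (Ne.symm (Finsupp.single_ne_zero.mpr one_ne_zero)),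
          mul_zero]
    · rw [if_neg hli, coeff_X]
      by_cases hji : j = i
      · subst hji
        rw [if_pos rfl, if_neg (Finsupp.single_ne_zero.mpr one_ne_zero), if_neg hli, mul_zero]
      · rw [if_neg hji]
        by_cases hlj : l = j
        · subst hlj; rw [if_pos rfl, if_pos rfl, mul_one]
        · rw [if_neg (fun h => hlj (Finsupp.single_left_injective one_ne_zero h)), if_neg hlj,
            mul_zero]
  simp_rw [hterm]
  rw [Finset.sum_ite_eq' Finset.univ j (fun _ => c j), if_pos (Finset.mem_univ j)]

/-- A chart linear part with some non-zero coefficient is non-zero. [folklore] -/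
theorem linearPart_ne_zero {k : Type*} [CommRing k] (i : Fin n) (c : Fin n → k) (hc : ∃ j, c j ≠ 0) :
    (∑ l : Fin n, C (c l) * (if l = i then (1 : MvPolynomial (Fin n) k) else X l)) ≠ 0 := by
  obtain ⟨j, hj⟩ := hc
  intro h0
  apply hj
  rw [← coeff_linearPart i j c, h0, coeff_zero]

/-- Reduction of the chart data modulo `ϖ`: if `h|_{X_i=0} = Σ_j a_j m_j` over `O`, then
`h̄|_{X_i=0} = Σ_j ā_j m_j` over `k = O/(ϖ)`. [folklore] -/
theorem map_restrict_eq (i : Fin n) {O' : Type*} [CommRing O'] (π : O →+* O')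
    {h : MvPolynomial (Fin n) O}
    {a : Fin n → O}
    (h2 : bind₁ (fun j : Fin n => if j = i then (0 : MvPolynomial (Fin n) O) else X j) h =
      ∑ j : Fin n, C (a j) * (if j = i then 1 else X j)) :
    bind₁ (fun j : Fin n => if j = i then (0 : MvPolynomial (Fin n) O') else X j)
        (MvPolynomial.map π h) =
      ∑ j : Fin n, C (π (a j)) * (if j = i then 1 else X j) := by
  have hf : (fun j : Fin n => MvPolynomial.map π
        (if j = i then (0 : MvPolynomial (Fin n) O) else X j)) =
      (fun j : Fin n => if j = i then (0 : MvPolynomial (Fin n) O') else X j) := by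
    funext j; split_ifs <;> simp
  have := congrArg (MvPolynomial.map π) h2
  rw [map_bind₁, hf, map_sum] at this
  rw [this]
  refine Finset.sum_congr rfl fun j _ => ?_
  rw [map_mul, map_C]
  split_ifs <;> simp

end LinearPart

/-! ## 6. H-COMB packaged: the strict transform of a relative hypersurface at `ϖ`-distance one from
the blown-up zero section, in the `i`-th chart -/

section CombCentre

variable {n : ℕ}

/-- **H-COMB (1), regularity along `E`.** Let `O` be a DVR with uniformizer `ϖ`, `g ∈ O[X₀,…,X_{n-1}]`
with constant term `g(0) = u·ϖ`, `u` a unit — the zero section of `𝔸ⁿ_O` lies at `ϖ`-DISTANCE EXACTLY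
ONE from the relative hypersurface `V(g)`. Then in the `i`-th chart `θ_i` of the blow-up of `𝔸ⁿ_O`
along the zero section, the transform `V(θ_i g)` (total = strict, the section not lying on `V(g)`)
is a regular local ring at every prime containing `X_i`, i.e. at EVERY point of the exceptional divisor
it meets. (Distance ≥ 2 is genuinely singular: `g = X₁ - ϖ²` gives `θ₀ g = X₀X₁ - ϖ²`, an `A₁` point.)
[folklore] -/
theorem comb_centre_regular (O : Type) [CommRing O] [IsDomain O] [IsDiscreteValuationRing O]
    (ϖ : O) (hϖ : Irreducible ϖ) (i : Fin n) (g : MvPolynomial (Fin n) O) (u : Oˣ)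
    (h0 : coeff 0 g = (u : O) * ϖ)
    (Q : Ideal (MvPolynomial (Fin n) O ⧸
      Ideal.span {bind₁ (fun j : Fin n => if j = i then X i else X i * X j) g}))
    [Q.IsPrime] (hQ : Ideal.Quotient.mk _ (X i) ∈ Q) :
    IsRegularLocalRing (Localization.AtPrime Q) := by
  obtain ⟨h, h1, -⟩ := exists_chart_eq i g
  rw [h0] at h1
  exact isRegularLocalRing_localization_of_adapted hϖ h1 Q hQ

/-- **H-COMB (2), the exceptional curve lies on the centre.** With `g(0) = u·ϖ`: `(θ_i g) ≤ (ϖ, X_i)`,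
i.e. the special fibre `e = V(ϖ, X_i)` of the exceptional divisor of the chart lies on `V(θ_i g)`.
[folklore] -/
theorem comb_centre_exceptional_le (O : Type) [CommRing O] (ϖ : O) (i : Fin n)
    (g : MvPolynomial (Fin n) O) (u : Oˣ) (h0 : coeff 0 g = (u : O) * ϖ) :
    Ideal.span {bind₁ (fun j : Fin n => if j = i then X i else X i * X j) g} ≤
      Ideal.span {C ϖ, X i} := by
  obtain ⟨h, h1, -⟩ := exists_chart_eq i g
  rw [h0] at h1
  exact span_le_of_adapted h1

/-- **H-COMB (3), trace on the exceptional divisor.** With `g(0) = u·ϖ`: the scheme-theoretic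
intersection `V(θ_i g) ∩ E` is the REDUCED exceptional hyperplane of the special fibre,
`(O[X]/(θ_i g))/(X_i) ≃+* k[X]/(X_i)` (`k = O/(ϖ)`): the exceptional curve `e` enters the special fibre
of the centre with multiplicity exactly one («`π*Z - e`»). [folklore] -/
theorem comb_centre_inter_exceptional (O : Type) [CommRing O] (ϖ : O) (i : Fin n)
    (g : MvPolynomial (Fin n) O) (u : Oˣ) (h0 : coeff 0 g = (u : O) * ϖ) :
    Nonempty (((MvPolynomial (Fin n) O ⧸
        Ideal.span {bind₁ (fun j : Fin n => if j = i then X i else X i * X j) g}) ⧸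
        Ideal.span {Ideal.Quotient.mk
          (Ideal.span {bind₁ (fun j : Fin n => if j = i then X i else X i * X j) g}) (X i)}) ≃+*
      (MvPolynomial (Fin n) (O ⧸ Ideal.span {ϖ}) ⧸
        Ideal.span {(X i : MvPolynomial (Fin n) (O ⧸ Ideal.span {ϖ}))})) := by
  obtain ⟨h, h1, -⟩ := exists_chart_eq i g
  rw [h0] at h1
  exact nonempty_quotient_X_equiv_of_adapted h1

/-- **H-COMB (4), special fibre and linear part.** With `g(0) = u·ϖ` there is `h` with
`θ_i g = u·ϖ + X_i·h`, whose restriction to `X_i = 0` is the chart linear part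
`a_i + Σ_{j≠i} a_j X_j` of `g`, and the special fibre of `V(θ_i g)` is `V(X_i · h̄) = e ∪ V(h̄) ⊂ 𝔸ⁿ_k`:
`(O[X]/(θ_i g))/(ϖ) ≃+* k[X]/(X_i·h̄)` — for `n = 2` the reduced-or-not nodal curve `e + ℓ′`,
`ℓ′ = V(h̄)` the strict transform of the special fibre `ℓ = V(ḡ)` of `V(g)`. [folklore] -/
theorem comb_centre_specialFibre (O : Type) [CommRing O] (ϖ : O) (i : Fin n)
    (g : MvPolynomial (Fin n) O) (u : Oˣ) (h0 : coeff 0 g = (u : O) * ϖ) :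
    ∃ h : MvPolynomial (Fin n) O,
      bind₁ (fun j : Fin n => if j = i then X i else X i * X j) g = C ((u : O) * ϖ) + X i * h ∧
      bind₁ (fun j : Fin n => if j = i then (0 : MvPolynomial (Fin n) O) else X j) h =
        ∑ j : Fin n, C (coeff (Finsupp.single j 1) g) * (if j = i then 1 else X j) ∧
      Nonempty (((MvPolynomial (Fin n) O ⧸
          Ideal.span {bind₁ (fun j : Fin n => if j = i then X i else X i * X j) g}) ⧸
          Ideal.span {Ideal.Quotient.mk
            (Ideal.span {bind₁ (fun j : Fin n => if j = i then X i else X i * X j) g}) (C ϖ)}) ≃+*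
        (MvPolynomial (Fin n) (O ⧸ Ideal.span {ϖ}) ⧸
          Ideal.span {X i * MvPolynomial.map (Ideal.Quotient.mk (Ideal.span {ϖ})) h})) := by
  obtain ⟨h, h1, h2⟩ := exists_chart_eq i g
  rw [h0] at h1
  exact ⟨h, h1, h2, nonempty_quotient_C_equiv_of_adapted h1⟩

/-- **H-COMB (5), flatness.** If `g(0) = u·ϖ` and the linear part of `g` does not vanish modulo `ϖ`
(the special fibre `V(ḡ)` of `V(g)` is smooth at the origin), then `O[X]/(θ_i g)` is FLAT over `O`:
the centre has no vertical component. [folklore] -/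
theorem comb_centre_flat (O : Type) [CommRing O] [IsDomain O] [IsDiscreteValuationRing O]
    (ϖ : O) (hϖ : Irreducible ϖ) (i : Fin n) (g : MvPolynomial (Fin n) O) (u : Oˣ)
    (h0 : coeff 0 g = (u : O) * ϖ) (hlin : ∃ j : Fin n, ¬ ϖ ∣ coeff (Finsupp.single j 1) g) :
    Module.Flat O (MvPolynomial (Fin n) O ⧸
      Ideal.span {bind₁ (fun j : Fin n => if j = i then X i else X i * X j) g}) := by
  obtain ⟨h, h1, h2⟩ := exists_chart_eq i g
  rw [h0] at h1
  refine flat_of_adapted hϖ h1 fun hh => ?_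
  have h3 := map_restrict_eq i (Ideal.Quotient.mk (Ideal.span {ϖ})) h2
  rw [hh, map_zero, eq_comm] at h3
  refine linearPart_ne_zero i _ ?_ h3
  obtain ⟨j, hj⟩ := hlin
  exact ⟨j, fun h' => hj (Ideal.mem_span_singleton.mp (Ideal.Quotient.eq_zero_iff_mem.mp h'))⟩

/-- **H-COMB (6), the exceptional curve is a reduced component and meets the rest transversally.**
If `g(0) = u·ϖ` and the linear part of `g` is non-zero modulo `ϖ`, then for the `h` of (4):
`X_i ∤ h̄` (the exceptional hyperplane `e = V(X_i)` is a component of multiplicity ONE of the special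
fibre `V(X_i·h̄)`), and `(X_i, h̄) = (X_i, ā_i + Σ_{j≠i} ā_j X_j)` — the residual part `V(h̄)` meets `e`
in the (reduced, linear) locus of the reduced linear part; for `n = 2`, `i = 0`: the single reduced
point `X₁ = -ā₀/ā₁` of `e` if `ā₁ ≠ 0`, nothing in this chart if `ā₁ = 0`. [folklore] -/
theorem comb_centre_exceptional_reduced (O : Type) [CommRing O] [IsDomain O] (ϖ : O) (i : Fin n)
    (g h : MvPolynomial (Fin n) O) (u : Oˣ)
    (h1 : bind₁ (fun j : Fin n => if j = i then X i else X i * X j) g = C ((u : O) * ϖ) + X i * h)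
    (hlin : ∃ j : Fin n, ¬ ϖ ∣ coeff (Finsupp.single j 1) g) :
    ¬ (X i ∣ MvPolynomial.map (Ideal.Quotient.mk (Ideal.span {ϖ})) h) ∧
      Ideal.span {(X i : MvPolynomial (Fin n) (O ⧸ Ideal.span {ϖ})),
          MvPolynomial.map (Ideal.Quotient.mk (Ideal.span {ϖ})) h} =
        Ideal.span {(X i : MvPolynomial (Fin n) (O ⧸ Ideal.span {ϖ})),
          ∑ j : Fin n, C (Ideal.Quotient.mk (Ideal.span {ϖ}) (coeff (Finsupp.single j 1) g)) *
            (if j = i then 1 else X j)} := by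
  obtain ⟨h', h1', h2⟩ := exists_chart_eq i g
  have hc0 : coeff 0 g = (u : O) * ϖ := by
    have := congrArg (coeff 0) h1
    rwa [coeff_zero_chart, coeff_add, coeff_C, if_pos rfl, coeff_X_mul', if_neg (by simp),
      add_zero] at this
  rw [hc0] at h1'
  have hh' : h' = h := mul_left_cancel₀ (X_ne_zero i) (add_left_cancel (h1'.symm.trans h1))
  rw [hh'] at h2
  have h3 := map_restrict_eq i (Ideal.Quotient.mk (Ideal.span {ϖ})) h2
  have hL : (∑ j : Fin n, C (Ideal.Quotient.mk (Ideal.span {ϖ}) (coeff (Finsupp.single j 1) g)) *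
      (if j = i then (1 : MvPolynomial (Fin n) (O ⧸ Ideal.span {ϖ})) else X j)) ≠ 0 := by
    refine linearPart_ne_zero i _ ?_
    obtain ⟨j, hj⟩ := hlin
    exact ⟨j, fun h' => hj (Ideal.mem_span_singleton.mp (Ideal.Quotient.eq_zero_iff_mem.mp h'))⟩
  refine ⟨fun ⟨q, hq⟩ => hL ?_, ?_⟩
  · rw [← h3, hq, map_mul, bind₁_X_right, if_pos rfl, zero_mul]
  · have hmem := sub_restrict_mem_span_X (O := O ⧸ Ideal.span {ϖ}) i
      (MvPolynomial.map (Ideal.Quotient.mk (Ideal.span {ϖ})) h)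
    rw [h3] at hmem
    apply le_antisymm
    · rw [Ideal.span_le, Set.insert_subset_iff, Set.singleton_subset_iff]
      refine ⟨Ideal.subset_span (by simp), ?_⟩
      have : MvPolynomial.map (Ideal.Quotient.mk (Ideal.span {ϖ})) h =
          (MvPolynomial.map (Ideal.Quotient.mk (Ideal.span {ϖ})) h - ∑ j : Fin n,
            C (Ideal.Quotient.mk (Ideal.span {ϖ}) (coeff (Finsupp.single j 1) g)) *
              (if j = i then 1 else X j)) + ∑ j : Fin n,
            C (Ideal.Quotient.mk (Ideal.span {ϖ}) (coeff (Finsupp.single j 1) g)) *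
              (if j = i then 1 else X j) := by ring
      rw [SetLike.mem_coe, this]
      exact Ideal.add_mem _ (Ideal.span_mono (Set.singleton_subset_iff.mpr (Set.mem_insert _ _)) hmem)
        (Ideal.subset_span (by simp))
    · rw [Ideal.span_le, Set.insert_subset_iff, Set.singleton_subset_iff]
      refine ⟨Ideal.subset_span (by simp), ?_⟩
      have : (∑ j : Fin n, C (Ideal.Quotient.mk (Ideal.span {ϖ}) (coeff (Finsupp.single j 1) g)) *
            (if j = i then (1 : MvPolynomial (Fin n) (O ⧸ Ideal.span {ϖ})) else X j)) =
          MvPolynomial.map (Ideal.Quotient.mk (Ideal.span {ϖ})) h -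
            (MvPolynomial.map (Ideal.Quotient.mk (Ideal.span {ϖ})) h - ∑ j : Fin n,
              C (Ideal.Quotient.mk (Ideal.span {ϖ}) (coeff (Finsupp.single j 1) g)) *
                (if j = i then 1 else X j)) := by ring
      rw [SetLike.mem_coe, this]
      exact Ideal.sub_mem _ (Ideal.subset_span (by simp))
        (Ideal.span_mono (Set.singleton_subset_iff.mpr (Set.mem_insert _ _)) hmem)

end CombCentre

end Summit.ResolutionOfSingularities.ResolutionOfSingularities.Theorems.EquisingularLiftNat.CombCentre

end
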